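import Summits.NavierStokesRegularity.NavierStokesRegularity.Theorems.TypeILiouvilleTypeIliouvilleNoTypeIIEternalEnergyLiouvilleQuiescentEpochs
import HarnessLib

/-!
# Forward quiescence: the zero flow on `[0, ∞) × ℝ³` is also an ω-limit of every EEL′-class profile
# (crux `TypeIliouvilleNoTypeII`, stmt-NavierStokesRegularity-0056; rigidity residual EEL′ of the
# pressure-free eternal split)

Helper file (theorems only).  Backward vanishing in density (`eternal_vanishesBackward`, p488411) uses
neither the equation nor an arrow of time: only `A_ess, E ≤ I` on all parabolic balls and smoothness.
Applied to the TIME-REVERSED field `s ↦ v(-s)` (same bounds: `Q_r(t, x) ↦ Q_r(-t + r², x)`; we go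
through the `sup`-form `A`, `cknA_reverse`, and the measure-preserving reflection of the cylinder,
`cknE_reverse`) it yields FORWARD vanishing in density, small FUTURE times, and — with the compactness
of the class modulo translations and forward uniqueness from a zero slice (`eq_zero_forward_of_slice_zero`,
p488957) — ω-limits vanishing on `[0, ∞) × ℝ³`:

* `eternal_vanishesForward` — `|{τ ∈ (0, a²) : ∫_{B_R}|v(τ)|² > ε}| / a² → 0` as `a → ∞`;
* `exists_futureTime_small` — for every `k` a time `τ > k` with `∫_{B(0,k+1)} |v(τ)|² ≤ 1/(k+1)`;
* `exists_omegaLimit_zero_forward` — times `τ_j → +∞` with `v(t + τ_j, y) → 0` for all `t ≥ 0`, `y`.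

With `exists_alphaLimit_zero_forward`: every member of the class — in particular every extremal
profile of the residual core — is quiescent (locally, along epochs) both in the remote past and in the
remote future: an ISOLATED BURST.  WHAT THIS IS NOT: not NS; EEL′ stays OPEN. [folklore]
-/

noncomputable section

-- the summit and its single problem share the name `NavierStokesRegularity` (D-0017 nested layout)
set_option linter.dupNamespace false

open Set Function Filter Topology MeasureTheory Metric TopologicalSpace
open scoped NNReal ENNReal

namespace Summit.NavierStokesRegularity.NavierStokesRegularity.Theorems.TypeIliouvilleNoTypeII.TypeIIZoom

open Literature.Analysis Literature.Analysis.FluidPDE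
open Summit.NavierStokesRegularity.NavierStokesRegularity.Theorems.PowerGaugeEulerLiouville.Backward
  (vanishesBackward_of_gauge_of_nonneg)

variable {v : ℝ → EuclideanSpace ℝ (Fin 3) → EuclideanSpace ℝ (Fin 3)}

/-! ## Time reversal of the scaled quantities at the origin -/

/-- **`A` under time reversal**: `A(v(-·); Q_r(0, x)) = A(v; Q_r(r², x))`. [folklore] -/
theorem cknA_reverse (r : ℝ) (x : EuclideanSpace ℝ (Fin 3)) :
    cknA r ((0 : ℝ), x) (fun s y => v (-s) y) = cknA r ((r ^ 2 : ℝ), x) v := by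
  unfold cknA
  apply le_antisymm
  · refine iSup₂_le fun t ht => ?_
    have ht' : -t ∈ Ioo ((r ^ 2 : ℝ) - r ^ 2) (r ^ 2) := by
      simp only [mem_Ioo] at ht ⊢; constructor <;> linarith [ht.1, ht.2]
    exact le_iSup₂ (f := fun t _ => (ENNReal.ofReal r)⁻¹ *
      ∫⁻ y in ball ((r ^ 2 : ℝ), x).2 r, ‖v t y‖ₑ ^ 2) (-t) ht'
  · refine iSup₂_le fun t ht => ?_
    have ht' : -t ∈ Ioo ((0 : ℝ) - r ^ 2) 0 := by
      simp only [mem_Ioo] at ht ⊢; constructor <;> linarith [ht.1, ht.2]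
    have h := le_iSup₂ (f := fun t _ => (ENNReal.ofReal r)⁻¹ *
      ∫⁻ y in ball ((0 : ℝ), x).2 r, ‖v (-t) y‖ₑ ^ 2) (-t) ht'
    simpa only [neg_neg] using h

/-- **`E` under time reversal**: `E(G(-·); Q_r(0, x)) = E(G; Q_r(r², x))` (the reflection
`(t, y) ↦ (-t, y)` preserves Lebesgue measure and maps `Q_r(0, x)` onto `Q_r(r², x)`). [folklore] -/
theorem cknE_reverse
    (G : ℝ → EuclideanSpace ℝ (Fin 3) → EuclideanSpace ℝ (Fin 3) →L[ℝ] EuclideanSpace ℝ (Fin 3))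
    (r : ℝ) (x : EuclideanSpace ℝ (Fin 3)) :
    cknE r ((0 : ℝ), x) (fun s y => G (-s) y) = cknE r ((r ^ 2 : ℝ), x) G := by
  unfold cknE
  congr 1
  set θ : ℝ × EuclideanSpace ℝ (Fin 3) → ℝ × EuclideanSpace ℝ (Fin 3) := fun q => (-q.1, q.2) with hθ
  have hθmp : MeasurePreserving θ volume volume := by
    have h := (Measure.measurePreserving_neg (volume : Measure ℝ)).prod
      (MeasurePreserving.id (volume : Measure (EuclideanSpace ℝ (Fin 3))))
    rw [Measure.volume_eq_prod]
    exact h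
  have hθemb : MeasurableEmbedding θ := by
    have hθinv : θ ∘ θ = id := funext fun q => by simp [hθ]
    exact MeasurableEquiv.measurableEmbedding
      { toFun := θ, invFun := θ, left_inv := fun q => by simp [hθ], right_inv := fun q => by simp [hθ],
        measurable_toFun := measurable_fst.neg.prodMk measurable_snd,
        measurable_invFun := measurable_fst.neg.prodMk measurable_snd }
  have hpre : θ ⁻¹' parabolicCylinder r ((r ^ 2 : ℝ), x) = parabolicCylinder r ((0 : ℝ), x) := by
    ext q
    simp only [mem_preimage, mem_parabolicCylinder, hθ]
    constructor
    · rintro ⟨⟨h1, h2⟩, h3⟩; exact ⟨⟨by linarith, by linarith⟩, h3⟩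
    · rintro ⟨⟨h1, h2⟩, h3⟩; exact ⟨⟨by linarith, by linarith⟩, h3⟩
  have h := hθmp.setLIntegral_comp_preimage_emb hθemb
    (fun q => ENNReal.ofReal (frobeniusNormSq (G q.1 q.2))) (parabolicCylinder r ((r ^ 2 : ℝ), x))
  rw [hpre] at h
  simpa only [hθ] using h

/-! ## Forward vanishing in density and small future times -/

/-- **EEL′-class profiles vanish FORWARD in density.**  For a jointly smooth `v` with
`A_ess(v; Q) ≤ I` and `E(∇v; Q) ≤ I` (`I ≠ ∞`) on all parabolic balls and every `R, ε > 0`: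
`|{τ ∈ (0, a²) : ∫_{B(0,R)}|v(τ)|² > ε}| / a² → 0` as `a → ∞` (backward vanishing of the
time-reversed field). [folklore] -/
theorem eternal_vanishesForward (hv : ContDiff ℝ (⊤ : ℕ∞) (uncurry v)) {I : ℝ≥0∞} (hI : I ≠ ⊤)
    (hA : ∀ r : ℝ, 0 < r → ∀ z : ℝ × EuclideanSpace ℝ (Fin 3), cknAEss r z v ≤ I)
    (hE : ∀ r : ℝ, 0 < r → ∀ z : ℝ × EuclideanSpace ℝ (Fin 3),
      cknE r z (fun s y => fderiv ℝ (v s) y) ≤ I)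
    {R ε : ℝ} (hR : 0 < R) (hε : 0 < ε) :
    Tendsto (fun a : ℝ =>
        volume {τ : ℝ | τ ∈ Set.Ioo 0 (a ^ 2) ∧
            ENNReal.ofReal ε < ∫⁻ y in ball (0 : EuclideanSpace ℝ (Fin 3)) R, ‖v τ y‖ₑ ^ 2} /
          ENNReal.ofReal (a ^ 2))
      atTop (𝓝 0) := by
  -- the reversed field
  set w : ℝ → EuclideanSpace ℝ (Fin 3) → EuclideanSpace ℝ (Fin 3) := fun s y => v (-s) y with hw
  have hwc : ContDiff ℝ (⊤ : ℕ∞) (uncurry w) := by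
    have e : uncurry w = uncurry v ∘ fun p : ℝ × EuclideanSpace ℝ (Fin 3) => (-p.1, p.2) := rfl
    rw [e]
    exact hv.comp (contDiff_fst.neg.prodMk contDiff_snd)
  have hH : HasWeakSpatialGradientOn (slab (EuclideanSpace ℝ (Fin 3)) (Set.Iio 0) isOpen_Iio) w
      (fun s y => fderiv ℝ (w s) y) :=
    hasWeakSpatialGradientOn_of_contDiffOn isOpen_Iio (fun z hz => hz)
      ((hwc.of_le (by exact_mod_cast le_top)).contDiffOn)
  have hIc : ((I.toNNReal : ℝ≥0) : ℝ≥0∞) = I := ENNReal.coe_toNNReal hI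
  have hA' : ∀ a : ℝ, 0 < a → ENNReal.ofReal (a ^ (2 * (0 : ℝ))) *
      cknA a (0 : ℝ × EuclideanSpace ℝ (Fin 3)) w ≤ ((I.toNNReal : ℝ≥0) : ℝ≥0∞) := by
    intro a ha
    rw [mul_zero, Real.rpow_zero, ENNReal.ofReal_one, one_mul, hIc,
      show (0 : ℝ × EuclideanSpace ℝ (Fin 3)) = ((0 : ℝ), (0 : EuclideanSpace ℝ (Fin 3))) from rfl,
      hw, cknA_reverse a 0]
    exact (cknA_le_cknAEss_of_continuous hv.continuous a _).trans (hA a ha _)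
  have hE' : ∀ a : ℝ, 0 < a → ENNReal.ofReal (a ^ (0 : ℝ)) *
      cknE a (0 : ℝ × EuclideanSpace ℝ (Fin 3)) (fun s y => fderiv ℝ (w s) y) ≤
        ((I.toNNReal : ℝ≥0) : ℝ≥0∞) := by
    intro a ha
    rw [Real.rpow_zero, ENNReal.ofReal_one, one_mul, hIc,
      show (0 : ℝ × EuclideanSpace ℝ (Fin 3)) = ((0 : ℝ), (0 : EuclideanSpace ℝ (Fin 3))) from rfl]
    have e : (fun s y => fderiv ℝ (w s) y) = fun s y => (fun s' y' => fderiv ℝ (v s') y') (-s) y := rfl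
    rw [e, cknE_reverse (fun s' y' => fderiv ℝ (v s') y') a 0]
    exact hE a ha _
  have h := vanishesBackward_of_gauge_of_nonneg le_rfl hH hA' hE' hR hε
  -- the bad sets correspond under `τ ↦ -τ`
  refine (tendsto_congr fun a => ?_).1 h
  congr 1
  have hset : {τ : ℝ | τ ∈ Set.Ioo 0 (a ^ 2) ∧
      ENNReal.ofReal ε < ∫⁻ y in ball (0 : EuclideanSpace ℝ (Fin 3)) R, ‖v τ y‖ₑ ^ 2} =
      Neg.neg ⁻¹' {τ : ℝ | τ ∈ Set.Ioo (-(a ^ 2)) 0 ∧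
        ENNReal.ofReal ε < ∫⁻ y in ball (0 : EuclideanSpace ℝ (Fin 3)) R, ‖w τ y‖ₑ ^ 2} := by
    ext τ
    simp only [mem_setOf_eq, mem_preimage, mem_Ioo, hw, neg_neg]
    constructor
    · rintro ⟨⟨h1, h2⟩, h3⟩; exact ⟨⟨by linarith, by linarith⟩, h3⟩
    · rintro ⟨⟨h1, h2⟩, h3⟩; exact ⟨⟨by linarith, by linarith⟩, h3⟩
  rw [hset]
  exact ((Measure.measurePreserving_neg (volume : Measure ℝ)).measure_preimage_emb
    (MeasurableEquiv.neg ℝ).measurableEmbedding _).symm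

/-- **Small future times exist**: for every `k : ℕ` there is `τ > k` with
`∫_{B(0,k+1)} |v(τ)|² ≤ 1/(k+1)` (forward vanishing in density: for large `a` fewer than a quarter of
the times in `(0, a²)` are active, while `(a²/2, a²)` is half of them). [folklore] -/
theorem exists_futureTime_small (hv : ContDiff ℝ (⊤ : ℕ∞) (uncurry v)) {I : ℝ≥0∞} (hI : I ≠ ⊤)
    (hA : ∀ r : ℝ, 0 < r → ∀ z : ℝ × EuclideanSpace ℝ (Fin 3), cknAEss r z v ≤ I)
    (hE : ∀ r : ℝ, 0 < r → ∀ z : ℝ × EuclideanSpace ℝ (Fin 3),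
      cknE r z (fun s y => fderiv ℝ (v s) y) ≤ I) (k : ℕ) :
    ∃ τ : ℝ, (k : ℝ) < τ ∧
      ∫⁻ y in ball (0 : EuclideanSpace ℝ (Fin 3)) ((k : ℝ) + 1), ‖v τ y‖ₑ ^ 2 ≤
        ENNReal.ofReal (1 / ((k : ℝ) + 1)) := by
  -- adapted from `exists_pastTime_small` (…ZeroSliceLimit.lean), windows reflected
  have hk1 : (0 : ℝ) < (k : ℝ) + 1 := by positivity
  have hlim := eternal_vanishesForward hv hI hA hE hk1 (one_div_pos.2 hk1)
  have hev1 : ∀ᶠ a : ℝ in atTop,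
      volume {τ : ℝ | τ ∈ Set.Ioo 0 (a ^ 2) ∧ ENNReal.ofReal (1 / ((k : ℝ) + 1)) <
          ∫⁻ y in ball (0 : EuclideanSpace ℝ (Fin 3)) ((k : ℝ) + 1), ‖v τ y‖ₑ ^ 2} /
        ENNReal.ofReal (a ^ 2) < 1 / 4 :=
    (tendsto_order.1 hlim).2 _ (by norm_num)
  have hev2 : ∀ᶠ a : ℝ in atTop, 2 * ((k : ℝ) + 1) ≤ a ^ 2 := by
    refine (eventually_ge_atTop (2 * ((k : ℝ) + 1))).mono fun a ha => ?_
    have h1 : (1 : ℝ) ≤ a := by linarith [(show (0 : ℝ) ≤ k from Nat.cast_nonneg k)]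
    nlinarith
  obtain ⟨a, ha1, ha2⟩ := (hev1.and hev2).exists
  set B : Set ℝ := {τ : ℝ | τ ∈ Set.Ioo 0 (a ^ 2) ∧ ENNReal.ofReal (1 / ((k : ℝ) + 1)) <
      ∫⁻ y in ball (0 : EuclideanSpace ℝ (Fin 3)) ((k : ℝ) + 1), ‖v τ y‖ₑ ^ 2} with hB
  have ha2pos : 0 < a ^ 2 := by linarith
  have hBlt : volume B < 1 / 4 * ENNReal.ofReal (a ^ 2) := by
    rwa [ENNReal.div_lt_iff (Or.inl (ENNReal.ofReal_pos.2 ha2pos).ne') (Or.inl ENNReal.ofReal_ne_top)]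
      at ha1
  -- the late half `J = (a²/2, a²)` is not contained in the bad set
  set J : Set ℝ := Set.Ioo (a ^ 2 / 2) (a ^ 2) with hJ
  have hJvol : volume J = ENNReal.ofReal (a ^ 2 / 2) := by
    rw [hJ, Real.volume_Ioo]; congr 1; ring
  have hnot : ¬ J ⊆ B := by
    intro hsub
    have h1 : ENNReal.ofReal (a ^ 2 / 2) ≤ volume B := hJvol ▸ measure_mono hsub
    have h2 : ENNReal.ofReal (a ^ 2 / 2) < 1 / 4 * ENNReal.ofReal (a ^ 2) := h1.trans_lt hBlt
    rw [show (1 : ℝ≥0∞) / 4 = ENNReal.ofReal (1 / 4) by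
        rw [ENNReal.ofReal_div_of_pos (by norm_num : (0:ℝ) < 4)]; simp,
      ← ENNReal.ofReal_mul (by norm_num)] at h2
    have h3 := (ENNReal.ofReal_lt_ofReal_iff (by positivity)).1 h2
    linarith
  obtain ⟨τ, hτJ, hτB⟩ := Set.not_subset.1 hnot
  refine ⟨τ, ?_, ?_⟩
  · have h := hτJ.1
    nlinarith
  · have hτI : τ ∈ Set.Ioo 0 (a ^ 2) := ⟨by linarith [hτJ.1], hτJ.2⟩
    by_contra hlt
    exact hτB ⟨hτI, not_le.1 hlt⟩

/-! ## ω-limits vanishing on the forward half-line -/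

/-- **The zero flow on `[0, ∞)` is an ω-limit.**  Every bounded eternal Oseen-mild smooth
divergence-free field with `A_ess, C, E ≤ I ≠ ∞` on all parabolic balls admits times `τ_j → +∞` with
`v(t + τ_j, y) → 0` for all `t ≥ 0` and all `y`. [folklore] -/
theorem exists_omegaLimit_zero_forward (hv : ContDiff ℝ (⊤ : ℕ∞) (uncurry v))
    (hdiv : ∀ t, VectorCalculus.IsDivFree (v t))
    (hmild : ∀ s t : ℝ, s < t → ∀ x, v t x = heatFlow (v s) (t - s) x - oseenDuhamel 1 s v v t x)
    {N : ℝ} (hbd : ∀ (t : ℝ) (x : EuclideanSpace ℝ (Fin 3)), ‖v t x‖ ≤ N) {I : ℝ≥0∞} (hI : I ≠ ⊤)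
    (hball : ∀ r : ℝ, 0 < r → ∀ z : ℝ × EuclideanSpace ℝ (Fin 3),
      cknAEss r z v ≤ I ∧ cknC r z v ≤ I ∧ cknE r z (fun s y => fderiv ℝ (v s) y) ≤ I) :
    ∃ τ : ℕ → ℝ, Tendsto τ atTop atTop ∧
      ∀ t : ℝ, 0 ≤ t → ∀ y : EuclideanSpace ℝ (Fin 3), Tendsto (fun j => v (t + τ j) y) atTop (𝓝 0) := by
  -- small future times
  have hsmall := fun k : ℕ => exists_futureTime_small hv hI (fun r hr z => (hball r hr z).1)
    (fun r hr z => (hball r hr z).2.2) k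
  choose σ hσgt hσsmall using hsmall
  -- a convergent subsequence of the time translates
  obtain ⟨φ, hφ, W, hW, -, hWmild, hWbd, -, hWlim, -⟩ :=
    exists_limit_of_translates hv hdiv hmild hbd hball σ (fun _ => 0)
  have hWlim' : ∀ t x, Tendsto (fun j => v (t + σ (φ j)) x) atTop (𝓝 (W t x)) := fun t x => by
    simpa using hWlim t x
  -- the zero slice of the limit (Fatou), as in `exists_alphaLimit_zeroSlice`
  have hW0 : ∀ y, W 0 y = 0 := by
    intro y
    set R : ℝ := ‖y‖ + 1 with hR
    have hyR : y ∈ ball (0 : EuclideanSpace ℝ (Fin 3)) R := by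
      rw [mem_ball, dist_zero_right, hR]; linarith
    have hWc : Continuous (W 0) := hW.continuous.comp (Continuous.prodMk_right (0 : ℝ))
    refine eq_zero_on_ball_of_ae hWc ?_ hyR
    have hmeas : ∀ j, AEMeasurable (fun x => ‖v (0 + σ (φ j)) x‖ₑ ^ 2)
        (volume.restrict (ball (0 : EuclideanSpace ℝ (Fin 3)) R)) := fun j =>
      ((hv.continuous.comp (Continuous.prodMk_right _)).measurable.enorm.pow_const 2).aemeasurable
    have hFatou := lintegral_liminf_le' (μ := volume.restrict (ball (0 : EuclideanSpace ℝ (Fin 3)) R))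
      (u := atTop) hmeas
    have hpt : ∀ x, liminf (fun j => ‖v (0 + σ (φ j)) x‖ₑ ^ 2) atTop = ‖W 0 x‖ₑ ^ 2 := fun x =>
      (ENNReal.Tendsto.pow (hWlim' 0 x).enorm).liminf_eq
    rw [lintegral_congr fun x => hpt x] at hFatou
    have hbound : ∀ᶠ j in atTop, ∫⁻ x in ball (0 : EuclideanSpace ℝ (Fin 3)) R, ‖v (0 + σ (φ j)) x‖ₑ ^ 2 ≤
        ENNReal.ofReal (1 / (((φ j : ℕ) : ℝ) + 1)) := by
      refine (eventually_ge_atTop (Nat.ceil R)).mono fun j hj => ?_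
      have hRj : R ≤ ((φ j : ℕ) : ℝ) + 1 := by
        have h1 : R ≤ (j : ℝ) := (Nat.le_ceil R).trans (by exact_mod_cast hj)
        have h2 : (j : ℝ) ≤ ((φ j : ℕ) : ℝ) := by exact_mod_cast hφ.id_le j
        linarith
      calc ∫⁻ x in ball (0 : EuclideanSpace ℝ (Fin 3)) R, ‖v (0 + σ (φ j)) x‖ₑ ^ 2
          ≤ ∫⁻ x in ball (0 : EuclideanSpace ℝ (Fin 3)) (((φ j : ℕ) : ℝ) + 1), ‖v (σ (φ j)) x‖ₑ ^ 2 := by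
            rw [zero_add]; exact lintegral_mono_set (ball_subset_ball hRj)
        _ ≤ ENNReal.ofReal (1 / (((φ j : ℕ) : ℝ) + 1)) := hσsmall (φ j)
    have hzero : Tendsto (fun j => ENNReal.ofReal (1 / (((φ j : ℕ) : ℝ) + 1))) atTop (𝓝 0) := by
      rw [← ENNReal.ofReal_zero]
      exact ENNReal.tendsto_ofReal (tendsto_one_div_add_atTop_nhds_zero_nat.comp hφ.tendsto_atTop)
    have hlim0 : liminf (fun j => ∫⁻ x in ball (0 : EuclideanSpace ℝ (Fin 3)) R,
        ‖v (0 + σ (φ j)) x‖ₑ ^ 2) atTop ≤ 0 := by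
      calc liminf (fun j => ∫⁻ x in ball (0 : EuclideanSpace ℝ (Fin 3)) R, ‖v (0 + σ (φ j)) x‖ₑ ^ 2) atTop
          ≤ liminf (fun j => ENNReal.ofReal (1 / (((φ j : ℕ) : ℝ) + 1))) atTop := liminf_le_liminf hbound
        _ = 0 := hzero.liminf_eq
    have hint0 : ∫⁻ x in ball (0 : EuclideanSpace ℝ (Fin 3)) R, ‖W 0 x‖ₑ ^ 2 = 0 :=
      le_antisymm (hFatou.trans hlim0) bot_le
    have hWm : AEMeasurable (fun x => ‖W 0 x‖ₑ ^ 2)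
        (volume.restrict (ball (0 : EuclideanSpace ℝ (Fin 3)) R)) :=
      (hWc.measurable.enorm.pow_const 2).aemeasurable
    have hae := (lintegral_eq_zero_iff' hWm).1 hint0
    filter_upwards [hae] with x hx
    have h2 : ‖W 0 x‖ₑ = 0 := by simpa using hx
    exact enorm_eq_zero.1 h2
  refine ⟨fun j => σ (φ j), ?_, fun t ht y => ?_⟩
  · refine tendsto_atTop.2 fun b => ?_
    refine (eventually_ge_atTop (Nat.ceil b)).mono fun j hj => ?_
    have h1 : ((φ j : ℕ) : ℝ) < σ (φ j) := hσgt (φ j)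
    have h2 : (j : ℝ) ≤ ((φ j : ℕ) : ℝ) := by exact_mod_cast hφ.id_le j
    have h3 : b ≤ (j : ℝ) := (Nat.le_ceil b).trans (by exact_mod_cast hj)
    linarith
  · have hzero : W t y = 0 := eq_zero_forward_of_slice_zero hW.continuous hWbd hWmild hW0 ht y
    rw [← hzero]
    exact hWlim' t y

end Summit.NavierStokesRegularity.NavierStokesRegularity.Theorems.TypeIliouvilleNoTypeII.TypeIIZoom

end
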